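import Mathlib
import HarnessLib
import Summits.KontsevichZagierPeriods.Zeta5Search.VWPOfPos
import Summits.KontsevichZagierPeriods.Zeta5Search.BaileyFromSorokinReflection
import Summits.KontsevichZagierPeriods.Zeta5Search.Descent22OnBoxFromZudilin
import Summits.KontsevichZagierPeriods.Zeta5Search.WedgeDictionaryDescent22Transport
import Summits.KontsevichZagierPeriods.Zeta5Search.WedgeDictionaryDescent22Weak
import Summits.KontsevichZagierPeriods.Zeta5Search.SorokinCensus.BalancedRaysOdd

/-!
# ζ(5) search — the cell's results conditional on Zudilin 2002 made UNCONDITIONAL (cell `pub-zeta5`, ct-1 g28)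

HONEST FRAMING: systematic search; no irrationality claim unless kernel-certified.  Identities between absolutely convergent
multiple integrals, very-well-poised series and rational dictionary data, and membership of certain integrals in `ℚ + ℚζ(3) + ℚζ(5)`;
nothing here is an irrationality result, a worthiness exponent or a denominator statement; no definition is introduced; records in
print unmoved.

`VWPOfPos.vwp_eq_integral_of_pos_holds` (this seat) proves the named fact `Zudilin2002.vwp_eq_integral_of_pos`.  This file feeds it to
the cell's theorems that carried it as a hypothesis `(hZ | h4 : vwp_eq_integral_of_pos)` — one-line specialisations, no new mathematics:

* **`baileyTransformClosed_holds`**, **`baileyTransform_holds`** — the Literature named facts `Zudilin2004.baileyTransformClosed` /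
  `Zudilin2004.baileyTransform` (Bailey's transformation of `F̃₅` on the closed / open admissible cone) DISCHARGED, via g25's
  `BaileyFromSorokinReflection.baileyTransform{Closed}_of_vwp_eq_integral`;
* `vwpDual_five_eq_J`, `vwpDual_five_eq_J_weak`, `J3_eq_vwpDual_five`, `J3_eq_vwpDual_five_weak` — Zudilin at `k = 3` in Brown–Zudilin's
  coordinates (`WedgeDictionaryDescent22Transport/Weak`);
* `rhs22_eq_on_box`, **`bz22_on_box`**, **`bz22_ones`** — Brown–Zudilin's (22) on the dictionary's box and at `a = (1,…,1)`
  (`Descent22OnBoxFromZudilin`);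
* `rawLocusOdd_of_converges`, **`balancedOddIntegrable_holds : BalancedOddIntegrable`** (the cell's node BALANCED ⇒ ODD for the generalized
  Sorokin family, integrability-hypothesis form), `balancedRaysOdd` (`SorokinCensus/RawLocusOddProof`, `…/BalancedRaysOdd`).

Theorems only.
-/

noncomputable section

namespace Summit.KontsevichZagierPeriods.Zeta5Search.VWPOfPosConsequences

open Finset
open Summit.KontsevichZagierPeriods.Zeta5Search.VWPOfPos (vwp_eq_integral_of_pos_holds)
open Summit.KontsevichZagierPeriods.Zeta5Search.DualSeries
open Summit.KontsevichZagierPeriods.Zeta5Search.WedgeDictionary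
open Summit.KontsevichZagierPeriods.Zeta5Search.SorokinCensus
open Literature.NumberTheory.Irrationality.BrownZudilin2022
  (vwpDual bOfA pOf qOf Converges cellularIntegral QOf J3 rhs22)
open Literature.NumberTheory.Irrationality.Zudilin2002 (sorokinIntegral)
open Literature.NumberTheory.Irrationality.Zudilin2004 (Admissible WeakAdmissible baileyTransform baileyTransformClosed)
open Literature.NumberTheory.Transcendental (zetaValue)

/-! ### 1. Bailey's transformation (Zudilin 2004) — two named facts discharged -/

/-- **Bailey's transformation of `F̃₅` on the CLOSED admissible cone [Zudilin2004, Sect. 4, Lemma 7 with (4.4)–(4.6), on (2.2)] — the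
named fact `Zudilin2004.baileyTransformClosed` HOLDS** (g25's reduction to Zudilin 2002 + `vwp_eq_integral_of_pos_holds`). -/
theorem baileyTransformClosed_holds : baileyTransformClosed :=
  BaileyFromSorokinReflection.baileyTransformClosed_of_vwp_eq_integral vwp_eq_integral_of_pos_holds

/-- **Bailey's transformation of `F̃₅` on the admissible cone [Zudilin2004, Sect. 4, Lemma 7 with (4.4)–(4.6); Prop. 2] — the named fact
`Zudilin2004.baileyTransform` HOLDS.** -/
theorem baileyTransform_holds : baileyTransform :=
  BaileyFromSorokinReflection.baileyTransform_of_vwp_eq_integral vwp_eq_integral_of_pos_holds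

/-! ### 2. Zudilin at `k = 3` in Brown–Zudilin's coordinates -/

/-- `λ(B)·F̃₅(B) = J₃(B₁+1; B₂+1, B₃+1, B₄+1 | B₀−B₃+2, B₀−B₄+2, B₀−B₅+2)` for strictly admissible integer `B` — unconditional. -/
theorem vwpDual_five_eq_J (B : ℕ → ℤ) (hB : Admissible B) :
    (lamOf B : ℝ) * vwpDual 5 B =
      sorokinIntegral 3 ((B 1 : ℝ) + 1) (fun i => (B (i + 2) : ℝ) + 1) (fun i => (B 0 : ℝ) - B (i + 3) + 2) :=
  WedgeDictionary.vwpDual_five_eq_J vwp_eq_integral_of_pos_holds B hB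

/-- The same on the closed (weakly admissible) cone — unconditional. -/
theorem vwpDual_five_eq_J_weak (B : ℕ → ℤ) (hB : WeakAdmissible B) :
    (lamOf B : ℝ) * vwpDual 5 B =
      sorokinIntegral 3 ((B 1 : ℝ) + 1) (fun i => (B (i + 2) : ℝ) + 1) (fun i => (B 0 : ℝ) - B (i + 3) + 2) :=
  WedgeDictionary.vwpDual_five_eq_J_weak vwp_eq_integral_of_pos_holds B hB

/-- `J₃(p₀,p₁,p₂,p₃−k; q₁,q₂,q₃−p₆+k) = λ_k · F̃₅(B(k))` for strictly admissible `B(k)` — unconditional. -/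
theorem J3_eq_vwpDual_five (a : Fin 8 → ℤ) (k : ℤ) (hadm : Admissible (bFive a k)) :
    J3 (pOf a 0) (pOf a 1) (pOf a 2) (pOf a 3 - k) (qOf a 0) (qOf a 1) (qOf a 2 - pOf a 6 + k) =
      (lamQ a k : ℝ) * vwpDual 5 (bFive a k) :=
  WedgeDictionary.J3_eq_vwpDual_five vwp_eq_integral_of_pos_holds a k hadm

/-- The same for weakly admissible `B(k)` — unconditional. -/
theorem J3_eq_vwpDual_five_weak (a : Fin 8 → ℤ) (k : ℤ) (hadm : WeakAdmissible (bFive a k)) :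
    J3 (pOf a 0) (pOf a 1) (pOf a 2) (pOf a 3 - k) (qOf a 0) (qOf a 1) (qOf a 2 - pOf a 6 + k) =
      (lamQ a k : ℝ) * vwpDual 5 (bFive a k) :=
  WedgeDictionary.J3_eq_vwpDual_five_weak vwp_eq_integral_of_pos_holds a k hadm

/-! ### 3. Brown–Zudilin's (22) on the dictionary's box -/

/-- **The right-hand side of (22) in closed form on the dictionary's box [BrownZudilin2022, Sect. 6, (22)–(24)] — unconditional**
(g25's `rhs22_eq_on_box_of_vwp`). -/
theorem rhs22_eq_on_box (a : Fin 8 → ℤ) (j : ℕ) (hj : j ∈ Icc 1 7) (hconv : Converges a)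
    (hreg : ∀ i ∈ Icc 1 7, 0 ≤ bOfA a i ∧ 2 * bOfA a i ≤ bOfA a 0 + 1) (hd : 0 ≤ dOf (bOfA a))
    (hpart : 2 * (bOfA a j + 1) ≤ bOfA a 0 + 1) (h2b : ∀ i ∈ Icc 1 7, 2 * bOfA a i ≤ bOfA a 0)
    (hp : ∀ i, 0 ≤ pOf a i) (hres : pOf a 4 + qOf a 3 ≤ pOf a 3)
    (hcl2 : bOfA a 0 - bOfA a 1 - bOfA a 2 ≤ dOf (bOfA a) + max 0 (max (bOfA a 7 - bOfA a 1) (bOfA a 7 - bOfA a 2))) :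
    rhs22 (pOf a) (qOf a) = 2 * ((QOf a : ℚ) : ℝ) * zetaValue 3 -
      2 * ((rhoOf a * (coeffU (bOfA a) * coeffV (Function.update (bOfA a) j (bOfA a j + 1)) -
              coeffU (Function.update (bOfA a) j (bOfA a j + 1)) * coeffV (bOfA a)) : ℚ) : ℝ) :=
  Descent22OnBoxFromZudilin.rhs22_eq_on_box_of_vwp vwp_eq_integral_of_pos_holds a j hj hconv hreg hd hpart h2b hp hres hcl2

/-- **Brown–Zudilin's decomposition (22) with (23) on the dictionary's box [BrownZudilin2022, Sect. 6, (22)–(23); Sect. 1, (4)] —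
unconditional**: `∃ P ∈ ℚ, I(a) = 2(Q(a)ζ(5) − P) + 2ζ(2)·rhs22(p;q)` under the nine box hypotheses (g25's `bz22_on_box_of_vwp`). -/
theorem bz22_on_box (a : Fin 8 → ℤ) (j : ℕ) (hj : j ∈ Icc 1 7) (hconv : Converges a)
    (hreg : ∀ i ∈ Icc 1 7, 0 ≤ bOfA a i ∧ 2 * bOfA a i ≤ bOfA a 0 + 1) (hd : 0 ≤ dOf (bOfA a))
    (hpart : 2 * (bOfA a j + 1) ≤ bOfA a 0 + 1) (h2b : ∀ i ∈ Icc 1 7, 2 * bOfA a i ≤ bOfA a 0)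
    (hp : ∀ i, 0 ≤ pOf a i) (hres : pOf a 4 + qOf a 3 ≤ pOf a 3)
    (hcl2 : bOfA a 0 - bOfA a 1 - bOfA a 2 ≤ dOf (bOfA a) + max 0 (max (bOfA a 7 - bOfA a 1) (bOfA a 7 - bOfA a 2))) :
    ∃ P : ℚ, cellularIntegral a =
      2 * ((QOf a : ℝ) * zetaValue 5 - (P : ℝ)) + 2 * zetaValue 2 * rhs22 (pOf a) (qOf a) :=
  Descent22OnBoxFromZudilin.bz22_on_box_of_vwp vwp_eq_integral_of_pos_holds a j hj hconv hreg hd hpart h2b hp hres hcl2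

/-- **The instance at Brown–Zudilin's first example `a = (1,…,1)` [BrownZudilin2022, Sect. 2, (5); Sect. 6, (22)] — unconditional**:
`∃ P ∈ ℚ, I(1,…,1) = 2(Q(1,…,1)ζ(5) − P) + 2ζ(2)·rhs22(p;q)`. -/
theorem bz22_ones :
    ∃ P : ℚ, cellularIntegral (fun _ => 1) =
      2 * ((QOf (fun _ => 1) : ℝ) * zetaValue 5 - (P : ℝ)) +
        2 * zetaValue 2 * rhs22 (pOf (fun _ => 1)) (qOf (fun _ => 1)) :=
  Descent22OnBoxFromZudilin.bz22_ones_of_vwp vwp_eq_integral_of_pos_holds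

/-! ### 4. BALANCED ⇒ ODD for the generalized Sorokin family -/

/-- **`RawLocusOdd` on convergent points — unconditional**: a raw admissible convergent point of the very-well-poised locus with `a₀ ≥ 1`
has value in `ℚ + ℚζ(3) + ℚζ(5)` (gen-5's `rawLocusOdd_of_converges`). -/
theorem rawLocusOdd_of_converges :
    ∀ q : GenPoint, q.Raw → q.OnLgen → q.Admissible → q.Converges → 1 ≤ q.a₀ → q.Odd :=
  SorokinCensus.rawLocusOdd_of_converges vwp_eq_integral_of_pos_holds

/-- **BALANCED ⇒ ODD (integrability-hypothesis form) — the cell's node `BalancedOddIntegrable` HOLDS unconditionally**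
(gen-5's `balancedOddIntegrable_of_vwp`). -/
theorem balancedOddIntegrable_holds : BalancedOddIntegrable :=
  SorokinCensus.balancedOddIntegrable_of_vwp vwp_eq_integral_of_pos_holds

/-- **Balanced rays are stably odd — unconditional** (gen-5's `balancedRaysOdd_of_vwp`): for a balanced admissible convergent point with
`a₀ ≥ 1`, every integrable ray point `n • p` (`n ≥ 1`) has value in `ℚ + ℚζ(3) + ℚζ(5)`. -/
theorem balancedRaysOdd :
    ∀ p : GenPoint, p.Admissible → p.Converges → 1 ≤ p.a₀ → p.Balanced →
      ∀ n ≥ 1, (p.smul n).Integrable → (p.smul n).Odd :=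
  SorokinCensus.balancedRaysOdd_of_vwp vwp_eq_integral_of_pos_holds

end Summit.KontsevichZagierPeriods.Zeta5Search.VWPOfPosConsequences

end
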